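import Summits.BirchSwinnertonDyer.BirchSwinnertonDyer.Theorems.GenusKolyvaginAtTwoPowDvdShaCardAtTwoRTLocalKernelQuadratic
import HarnessLib

/-!
# Route `GenusKolyvaginAtTwo`, LINE 18 / LINE 19 (stmt-BirchSwinnertonDyer-23242 / -23379), bit accounting of the `d_K`-relaxation:
# MATSUNO'S `W_{v,K}` VANISHES AT A SPLIT PLACE (`K_w = ℚ_v`)

Seat `bsd-line-gk2-p3` g16 (cell `bsd-f1-sign2`), `--supports stmt-BirchSwinnertonDyer-23242` (helper; closes nothing).  THEOREMS ONLY,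
UNCONDITIONAL; BSD is not proved by any of this.

If `[K_w : ℚ_v] = 1` (a place `v` split in `K`, e.g. every `p ∣ N` under the Heegner hypothesis), the image of `Γ_{K_w} → Γ_{ℚ_v}` is
all of `Γ_{ℚ_v}` (`galRange = Γ_{j(K_w)}` with `j(K_w) = ℚ_v`), so no non-zero class of `H¹(ℚ_v, E)` dies in `H¹(K_w, E)`:
`W_{v,K} = 0`.  With `localKernel_eq_bot_of_finrank_eq_two_of_forall_two_smul(_rat)` and `two_nsmul_eq_zero_of_mem_localKernel`
(this seat) this completes the local picture of the (+)-descent away from the inert places: the relaxation lives only at the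
ramified primes of `d_K`, is `2`-torsion there, and vanishes where `E(ℚ_p)[2] = 0`.

* `localRestrictionKer_eq_bot_of_finrank_eq_one` — general field `F` of characteristic `0`, `[L : F] = 1`.
* `localKernel_eq_bot_of_finrank_eq_one` — Matsuno's `W_{v,K}` for `E/ℚ`.

References: [SerreGaloisCohomology1997] I.§2.4; [Matsuno2009] §3 (p. 451).
-/

set_option autoImplicit false
-- the Theorems namespace of this sub repeats the summit name by design (D-0017 nested layout)
set_option linter.dupNamespace false

noncomputable section

open scoped Classical

namespace Summit.BirchSwinnertonDyer.BirchSwinnertonDyer.Theorems.GenusExact.PlusDescent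

open WeierstrassCurve Literature.NumberTheory.EllipticCurves Literature.NumberTheory.GaloisRepresentations
  Literature.Barriers.BirchSwinnertonDyer IntermediateField NumberField IsDedekindDomain

universe u

/-- **`ker(H¹(F, E) → H¹(L, E)) = 0` when `[L : F] = 1`** (`F` of characteristic `0`): the restriction `Γ_L → Γ_F` is onto
(`galRange L` is the fixing group of the copy of `L`, which is `F` itself), and a crossed homomorphism vanishing on all of `Γ_F`
is zero. [cite: SerreGaloisCohomology1997, I.§2.4] -/
theorem localRestrictionKer_eq_bot_of_finrank_eq_one {F : Type u} [Field F] [CharZero F]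
    (W : WeierstrassCurve F) (L : Type u) [Field L] [Algebra F L] [FiniteDimensional F L]
    (h1 : Module.finrank F L = 1) : W.localRestrictionKer L = ⊥ := by
  haveI : Algebra.IsAlgebraic F L := Algebra.IsAlgebraic.of_finite F L
  haveI : IsGalois F (AlgebraicClosure F) := {}
  set e : AlgebraicClosure F ≃ₐ[F] AlgebraicClosure L := algEquivOfEmb L (closureEmb (K := F) L) with he
  set j : L →ₐ[F] AlgebraicClosure F :=
    ((e.symm : AlgebraicClosure L →ₐ[F] AlgebraicClosure F).comp
      (IsScalarTower.toAlgHom F L (AlgebraicClosure L))) with hj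
  set F' : IntermediateField F (AlgebraicClosure F) := j.fieldRange with hF'
  set N : Subgroup (Field.absoluteGaloisGroup F) := galRange (K := F) L with hNdef
  have hN : N = F'.fixingSubgroup := galRange_eq_fixingSubgroup_fieldRange L
  let eL : L ≃ₐ[F] F' := AlgHom.equivFieldRange j
  haveI : FiniteDimensional F F' := LinearEquiv.finiteDimensional eL.toLinearEquiv
  have hNopen : IsOpen (N : Set (Field.absoluteGaloisGroup F)) := by
    rw [hN]; exact IntermediateField.fixingSubgroup_isOpen F'
  have hidx : N.index = 1 := by
    rw [hN]
    refine ((IntermediateField.finrank_eq_fixingSubgroup_index F').symm.trans ?_)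
    rw [← eL.toLinearEquiv.finrank_eq, h1]
  haveI : N.FiniteIndex := ⟨by rw [hidx]; norm_num⟩
  rw [eq_bot_iff]
  intro c hc
  obtain ⟨f, hf⟩ := resKer_le_range_inflClass (resGal (K := F) L) (pointsMap W L) (pointsMap_smul W L)
    (pointsMapOfEmb_bijective L W _) N hNopen (by rw [hNdef]; exact le_rfl) hc
  rw [AddSubgroup.mem_bot, ← hf]
  have h := index_nsmul_inflClass N hNopen f
  rwa [hidx, one_smul] at h

/-- **Matsuno's `W_{v,K}` vanishes at a split place**: for `E/ℚ`, a number field `K` and finite places `w ∣ v` with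
`[K_w : ℚ_v] = 1` (e.g. `v` split in the quadratic field `K` — every `p ∣ N` under the Heegner hypothesis),
`W_{v,K} = ker(H¹(ℚ_v, E) → H¹(K_w, E)) = 0`. [cite: Matsuno2009, §3 (p. 451, W_{v,K})] -/
theorem localKernel_eq_bot_of_finrank_eq_one (E : WeierstrassCurve ℚ) (K : Type) [Field K] [NumberField K]
    (v : HeightOneSpectrum (𝓞 ℚ)) (w : HeightOneSpectrum (𝓞 K)) [w.asIdeal.LiesOver v.asIdeal]
    (h1 : letI : Algebra (v.adicCompletion ℚ) (w.adicCompletion K) :=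
        (Literature.NumberTheory.EllipticCurves.adicCompletionMap (K := ℚ) K v w).toAlgebra
      Module.finrank (v.adicCompletion ℚ) (w.adicCompletion K) = 1) :
    Matsuno2009.localKernel E K v w = ⊥ := by
  letI : Algebra (v.adicCompletion ℚ) (w.adicCompletion K) :=
    (Literature.NumberTheory.EllipticCurves.adicCompletionMap (K := ℚ) K v w).toAlgebra
  haveI : CharZero (v.adicCompletion ℚ) :=
    charZero_of_injective_algebraMap (algebraMap ℚ (v.adicCompletion ℚ)).injective
  haveI : FiniteDimensional (v.adicCompletion ℚ) (w.adicCompletion K) := Module.finite_of_finrank_eq_succ h1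
  unfold Matsuno2009.localKernel
  exact localRestrictionKer_eq_bot_of_finrank_eq_one _ (w.adicCompletion K) h1

end Summit.BirchSwinnertonDyer.BirchSwinnertonDyer.Theorems.GenusExact.PlusDescent

end
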